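import Summits.QuantumAdvantage.QuantumAdvantage.Theorems.ParityPinningA

/-! # ParityPinningB — part 2/3 (mechanical split for landing of `ParityPinning`; content verbatim; scopes re-opened with their variables) -/

set_option linter.dupNamespace false -- D-0017: single-problem summit ⇒ `QuantumAdvantage.QuantumAdvantage` by design

namespace Summit.QuantumAdvantage.QuantumAdvantage.Theorems.PairFreezing
open Classical Finset Summit.QuantumAdvantage.AdviceFreeQNC0
open Literature.Computability.MetaComplexity Literature.Computability.MetaComplexity.Smolensky
open Literature.Computability.Complexity (parityFn)
open Summit.QuantumAdvantage.QuantumAdvantage.Theses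
variable {n : ℕ}

section Rel
variable {n : ℕ}

/-! ### §11 THEOREM: the polylog feature rung for balanced feature maps (`p ≠ 3`) -/

set_option maxHeartbeats 400000 in
/-- **THEOREM (parity pinning, relative routing).** `WalkHardFFeatBal p` for every prime `p ≠ 3`: the §9 routing
with the ABSOLUTE per-cell error `(½·D/√M)·2ⁿ` replaced by the RELATIVE loss `¼·#U_v` of `denseLose_rel` — the cell
losses now SUM to `¼·#DENSE` whatever `K` is; `M = (log₂ n)^A`, `E = K + E₀`, threshold `24(M+E)+8`, sparse budget
`balBudget`, `θ = 1 − (1 − θ_S)/8`. -/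
theorem walkHardFFeatBal_holds (p : ℕ) [Fact p.Prime] (hp3 : p ≠ 3) : WalkHardFFeatBal p := by
  obtain ⟨θS, hθS, HS⟩ := walkHardFShots p hp3
  have h1θ : 0 < 1 - θS := by linarith
  obtain ⟨E₀, hE₀⟩ : ∃ E₀ : ℕ, 12 / (1 - θS) ≤ (2 : ℝ) ^ E₀ := by
    obtain ⟨E, hE⟩ := pow_unbounded_of_one_lt (12 / (1 - θS)) (by norm_num : (1 : ℝ) < 2)
    exact ⟨E, hE.le⟩
  obtain ⟨η, hηdef⟩ : ∃ η : ℝ, η = 1 / 4 := ⟨_, rfl⟩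
  obtain ⟨η₁, hη₁def⟩ : ∃ η₁ : ℝ, η₁ = 1 / 4 := ⟨_, rfl⟩
  have hη : (0 : ℝ) < η := by rw [hηdef]; norm_num
  have hη₁ : (0 : ℝ) < η₁ := by rw [hη₁def]; norm_num
  have hη₁1 : η₁ ≤ 1 := by rw [hη₁def]; norm_num
  have hη₁η : η₁ ≤ η := by rw [hη₁def, hηdef]
  have hηθ : 0 < η₁ * (1 - θS) := mul_pos hη₁ h1θ
  refine ⟨1 - η₁ * (1 - θS) / 2, by linarith, fun C C' A => ?_⟩
  obtain ⟨n₁, hn₁⟩ := HS (C + C')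
  obtain ⟨N₁, hN₁⟩ := DWalk.const_mul_logPow_le' ((55 + 24 * E₀) ^ 3) (3 * (A + C') + (2 * (C + C') + 2))
  refine ⟨max (max n₁ 4) N₁, fun n hn K hK c f tab hdeg hbal => ?_⟩
  have hn1 : n₁ ≤ n := le_trans (le_trans (le_max_left _ _) (le_max_left _ _)) hn
  have hn4 : 4 ≤ n := le_trans (le_trans (le_max_right _ _) (le_max_left _ _)) hn
  have hN1 : N₁ ≤ n := le_trans (le_max_right _ _) hn
  have hnL : 1 ≤ n := by omega
  have hℓ2 : 2 ≤ Nat.log 2 n := Nat.le_log_of_pow_le (by norm_num) (by simpa using hn4)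
  have hℓ1 : 1 ≤ Nat.log 2 n := by omega
  have hδ : (0 : ℝ) < η₁ * (1 - θS) / (2 * 2 ^ K) := div_pos hηθ (by positivity)
  have h2n : (0 : ℝ) < (2 : ℝ) ^ n := by positivity
  -- the parameters
  obtain ⟨M, hMdef⟩ : ∃ M : ℕ, M = Nat.log 2 n ^ A := ⟨_, rfl⟩
  have hM1 : 1 ≤ M := by rw [hMdef]; exact Nat.one_le_pow _ _ (by omega)
  obtain ⟨E, hEdef⟩ : ∃ E : ℕ, E = K + E₀ := ⟨_, rfl⟩
  obtain ⟨T, hTdef⟩ : ∃ T : ℕ, T = 24 * (M + E) + 7 := ⟨_, rfl⟩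
  have hT1 : T + 1 = 24 * (M + E) + 8 := by omega
  -- sparse budget `T³·(log₂ n)^{2(C+C')+2} ≤ n`
  have hbudget : T ^ 3 * Nat.log 2 n ^ (2 * (C + C') + 2) ≤ n :=
    balBudget hN₁ hN1 hℓ1 hK hMdef hEdef hTdef

  set y : Fin (n + 1) → (Fin n → Bool) → Bool := fun g u => tab g (fun j => f j u) with hy
  set φ : (Fin n → Bool) → (Fin K → Bool) := fun u j => f j u with hφ
  set ct : (Fin K → Bool) → ℕ := fun v => (univ.filter fun h : Fin (n + 1) => tab h v = true).card with hct
  set y' : Fin (n + 1) → (Fin n → Bool) → Bool := fun g u => tab g (φ u) && decide (ct (φ u) ≤ T) with hy'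
  -- (1) every function of the feature pattern has degree ≤ K·(log n)^C ≤ (log n)^(C+C')
  have hdegPat : ∀ t : (Fin K → Bool) → Bool, HasDegF p (fun u => t (φ u)) ((Nat.log 2 n) ^ (C + C')) := by
    intro t
    unfold HasDegF
    have h := GapFibre.ind_mem_lowDeg_of_pattern (F := ZMod p) (L := n) (D := (Nat.log 2 n) ^ C)
      (univ : Finset (Fin K)) (fun j u => f j u) (fun j _ => hdeg j) (fun u => t (φ u))
      (fun z z' hzz' => by
        have : φ z = φ z' := funext fun j => hzz' j (mem_univ j)
        simp only [this])
    rw [Finset.card_univ, Fintype.card_fin] at h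
    refine lowDeg_mono ?_ h
    calc K * (Nat.log 2 n) ^ C ≤ (Nat.log 2 n) ^ C' * (Nat.log 2 n) ^ C := Nat.mul_le_mul_right _ hK
      _ = (Nat.log 2 n) ^ (C + C') := by ring
  have hdeg' : ∀ g, HasDegF p (y' g) ((Nat.log 2 n) ^ (C + C')) := fun g =>
    hdegPat (fun v => tab g v && decide (ct v ≤ T))
  -- (2) the sparse-routed strategy fires ≤ T cuts on every input
  have hshots' : ∀ u, (univ.filter fun g : Fin (n + 1) => y' g u = true).card ≤ T := by
    intro u
    by_cases hs : ct (φ u) ≤ T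
    · refine le_trans (Finset.card_le_card fun g hg => ?_) hs
      rw [mem_filter] at hg ⊢
      refine ⟨mem_univ _, ?_⟩
      have h2 := hg.2
      rw [hy'] at h2
      simp only [Bool.and_eq_true] at h2
      exact h2.1
    · have hempty : (univ.filter fun g : Fin (n + 1) => y' g u = true) = ∅ := by
        refine Finset.filter_eq_empty_iff.mpr fun g _ => ?_
        rw [hy']
        simp [hs]
      rw [hempty, Finset.card_empty]; omega
  -- (3) strategies that agree at `u` have the same win bit at `u`
  have hwin_congr : ∀ (y₁ y₂ : Fin (n + 1) → (Fin n → Bool) → Bool) (u : Fin n → Bool),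
      (∀ g, y₁ g u = y₂ g u) → ringWinU c y₁ u = ringWinU c y₂ u := by
    intro y₁ y₂ u h
    unfold ringWinU
    have : (univ.filter fun g : Fin (n + 1) => y₁ g u = true ∧ (c + g.val + walkExp u g.val) % 3 ≠ 0) =
        univ.filter fun g : Fin (n + 1) => y₂ g u = true ∧ (c + g.val + walkExp u g.val) % 3 ≠ 0 :=
      Finset.filter_congr fun g _ => by rw [h g]
    rw [this]
  have hfix : ∀ (u : Fin n → Bool) (v : Fin K → Bool), φ u = v →
      ringWinU c y u = ringWinU c (fun h _ => tab h v) u := by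
    intro u v hv
    refine hwin_congr y (fun h _ => tab h v) u fun g => ?_
    rw [hy]
    show tab g (φ u) = tab g v
    rw [hv]
  -- (4) X := #(WIN ∩ sparse classes) ≤ #WIN(y') ≤ θ_S·2ⁿ, and X ≤ #sparse
  have hXsub : (univ.filter fun u : Fin n → Bool => ringWinU c y u = true ∧ ct (φ u) ≤ T) ⊆
      univ.filter fun u : Fin n → Bool => ringWinU c y' u = true := by
    intro u hu
    rw [mem_filter] at hu ⊢
    refine ⟨mem_univ _, ?_⟩
    rw [← hu.2.1]
    refine hwin_congr y' y u fun g => ?_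
    rw [hy', hy]
    show (tab g (φ u) && decide (ct (φ u) ≤ T)) = tab g (φ u)
    simp [hu.2.2]
  have hX1 : ((univ.filter fun u : Fin n → Bool => ringWinU c y u = true ∧ ct (φ u) ≤ T).card : ℝ) ≤
      θS * (2 : ℝ) ^ n := by
    have hy'win := hn₁ n hn1 c T y' hdeg' hshots' hbudget
    have hle : ((univ.filter fun u : Fin n → Bool => ringWinU c y u = true ∧ ct (φ u) ≤ T).card : ℝ) ≤
        ((univ.filter fun u : Fin n → Bool => ringWinU c y' u = true).card : ℝ) := by
      exact_mod_cast Finset.card_le_card hXsub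
    exact le_trans hle hy'win
  have hX2 : (univ.filter fun u : Fin n → Bool => ringWinU c y u = true ∧ ct (φ u) ≤ T).card ≤
      (univ.filter fun u : Fin n → Bool => ct (φ u) ≤ T).card :=
    Finset.card_le_card fun u hu => by
      rw [mem_filter] at hu ⊢; exact ⟨hu.1, hu.2.2⟩
  -- (5) WIN and the cube split by sparse / dense pattern
  have hWsplit := Finset.card_filter_add_card_filter_not
    (s := univ.filter fun u : Fin n → Bool => ringWinU c y u = true) (p := fun u => ct (φ u) ≤ T)
  rw [Finset.filter_filter, Finset.filter_filter] at hWsplit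
  have hABsplit := Finset.card_filter_add_card_filter_not
    (s := (univ : Finset (Fin n → Bool))) (p := fun u => ct (φ u) ≤ T)
  rw [card_univ, Fintype.card_fun, Fintype.card_bool, Fintype.card_fin] at hABsplit
  -- (6) dense cells: balanced by hypothesis
  set DV : Finset (Fin K → Bool) := univ.filter fun v => ¬ ct v ≤ T with hDV
  have hbalv : ∀ v : Fin K → Bool, Balanced (fun u => decide (φ u = v)) M := by
    intro v; rw [hMdef]; exact hbal v

  have hcellD : ∀ v ∈ DV,
      η * ((univ.filter fun u : Fin n → Bool => decide (φ u = v) = true).card : ℝ) ≤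
        ((univ.filter fun u : Fin n → Bool => decide (φ u = v) = true ∧
            ringWinU c (fun h _ => tab h v) u = false).card : ℝ) +
          η₁ * (1 - θS) / (2 * 2 ^ K) * (2 : ℝ) ^ n := by
    intro v hv
    have h21 : 24 * (M + E) + 8 ≤ (univ.filter fun h : Fin (n + 1) => tab h v = true).card := by
      rw [hDV, mem_filter] at hv
      have h2 := hv.2
      simp only [hct] at h2
      rw [← hT1]
      omega
    have hlaw : (1 / 4 : ℝ) * ((univ.filter fun u : Fin n → Bool => decide (φ u = v) = true).card : ℝ) ≤
        ((univ.filter fun u : Fin n → Bool => decide (φ u = v) = true ∧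
            ringWinU c (fun h _ => tab h v) u = false).card : ℝ)
          + ((3 / 2) / 2 ^ E) * (2 : ℝ) ^ n :=
      denseLose_rel hnL c (fun h => tab h v) (fun u => decide (φ u = v)) (hbalv v) h21
    -- the error coefficient `(3/2)/2^E ≤ η₁(1−θ_S)/(2·2^K)`, i.e. `2^{E₀} ≥ 12/(1−θ_S)`
    have hcoef : ((3 / 2 : ℝ) / 2 ^ E) * (2 : ℝ) ^ n ≤ η₁ * (1 - θS) / (2 * 2 ^ K) * (2 : ℝ) ^ n := by
      refine mul_le_mul_of_nonneg_right ?_ h2n.le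
      rw [hη₁def, hEdef, pow_add]
      have h2K : (0 : ℝ) < (2 : ℝ) ^ K := by positivity
      have h2E : (0 : ℝ) < (2 : ℝ) ^ E₀ := by positivity
      rw [div_le_div_iff₀ (by positivity) (by positivity)]
      have h12 : 12 ≤ (1 - θS) * (2 : ℝ) ^ E₀ := by
        have := (div_le_iff₀ h1θ).1 hE₀
        linarith
      nlinarith [h2K, h2E, h12]
    rw [hηdef]
    linarith

  have hcellWL : ∀ v : Fin K → Bool,
      ((univ.filter fun u : Fin n → Bool => decide (φ u = v) = true ∧ ringWinU c y u = true).card : ℝ) +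
        ((univ.filter fun u : Fin n → Bool => decide (φ u = v) = true ∧
            ringWinU c (fun h _ => tab h v) u = false).card : ℝ) =
        ((univ.filter fun u : Fin n → Bool => decide (φ u = v) = true).card : ℝ) := by
    intro v
    have hsplit := Finset.card_filter_add_card_filter_not
      (s := univ.filter fun u : Fin n → Bool => decide (φ u = v) = true) (p := fun u => ringWinU c y u = true)
    rw [Finset.filter_filter, Finset.filter_filter] at hsplit
    have hset : (univ.filter fun u : Fin n → Bool => decide (φ u = v) = true ∧ ¬ ringWinU c y u = true) =
        univ.filter fun u : Fin n → Bool =>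
          decide (φ u = v) = true ∧ ringWinU c (fun h _ => tab h v) u = false := by
      refine Finset.filter_congr fun u _ => ?_
      constructor
      · rintro ⟨hv, hw⟩
        refine ⟨hv, ?_⟩
        rw [← hfix u v (by rwa [decide_eq_true_eq] at hv)]
        simpa using hw
      · rintro ⟨hv, hw⟩
        refine ⟨hv, ?_⟩
        rw [← hfix u v (by rwa [decide_eq_true_eq] at hv)] at hw
        simpa using hw
    rw [hset] at hsplit
    exact_mod_cast hsplit
  have hYsum : ((univ.filter fun u : Fin n → Bool => ringWinU c y u = true ∧ ¬ ct (φ u) ≤ T).card : ℝ) =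
      ∑ v ∈ DV, ((univ.filter fun u : Fin n → Bool =>
        decide (φ u = v) = true ∧ ringWinU c y u = true).card : ℝ) := by
    have h := Finset.card_eq_sum_card_fiberwise (f := φ)
      (s := univ.filter fun u : Fin n → Bool => ringWinU c y u = true ∧ ¬ ct (φ u) ≤ T) (t := DV)
      (fun u hu => by
        rw [Finset.mem_coe, mem_filter] at hu
        rw [Finset.mem_coe, hDV, mem_filter]
        exact ⟨mem_univ _, hu.2.2⟩)
    rw [h, Nat.cast_sum]
    refine Finset.sum_congr rfl fun v hvD => ?_
    rw [Nat.cast_inj, Finset.filter_filter]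
    congr 1
    refine Finset.filter_congr fun u _ => ?_
    rw [decide_eq_true_eq]
    constructor
    · rintro ⟨⟨hw, _⟩, hv⟩; exact ⟨hv, hw⟩
    · rintro ⟨hv, hw⟩
      refine ⟨⟨hw, ?_⟩, hv⟩
      rw [hDV, mem_filter] at hvD
      rw [hv]; exact hvD.2
  have hBsum : ((univ.filter fun u : Fin n → Bool => ¬ ct (φ u) ≤ T).card : ℝ) =
      ∑ v ∈ DV, ((univ.filter fun u : Fin n → Bool => decide (φ u = v) = true).card : ℝ) := by
    have h := Finset.card_eq_sum_card_fiberwise (f := φ)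
      (s := univ.filter fun u : Fin n → Bool => ¬ ct (φ u) ≤ T) (t := DV)
      (fun u hu => by
        rw [Finset.mem_coe, mem_filter] at hu
        rw [Finset.mem_coe, hDV, mem_filter]
        exact ⟨mem_univ _, hu.2⟩)
    rw [h, Nat.cast_sum]
    refine Finset.sum_congr rfl fun v hvD => ?_
    rw [Nat.cast_inj, Finset.filter_filter]
    congr 1
    refine Finset.filter_congr fun u _ => ?_
    rw [decide_eq_true_eq]
    constructor
    · rintro ⟨_, hv⟩; exact hv
    · intro hv
      refine ⟨?_, hv⟩
      rw [hDV, mem_filter] at hvD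
      rw [hv]; exact hvD.2
  have hcell : ∀ v ∈ DV,
      η₁ * ((univ.filter fun u : Fin n → Bool => decide (φ u = v) = true).card : ℝ) +
        ((univ.filter fun u : Fin n → Bool => decide (φ u = v) = true ∧ ringWinU c y u = true).card : ℝ) ≤
        ((univ.filter fun u : Fin n → Bool => decide (φ u = v) = true).card : ℝ) +
          η₁ * (1 - θS) / (2 * 2 ^ K) * (2 : ℝ) ^ n := by
    intro v hvD
    have h1 := hcellD v hvD
    have h2 := hcellWL v
    have hUv : (0 : ℝ) ≤ ((univ.filter fun u : Fin n → Bool => decide (φ u = v) = true).card : ℝ) := by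
      positivity
    have h3 : η₁ * ((univ.filter fun u : Fin n → Bool => decide (φ u = v) = true).card : ℝ) ≤
        η * ((univ.filter fun u : Fin n → Bool => decide (φ u = v) = true).card : ℝ) :=
      mul_le_mul_of_nonneg_right hη₁η hUv
    linarith
  have hE0 : (0 : ℝ) ≤ η₁ * (1 - θS) / (2 * 2 ^ K) * (2 : ℝ) ^ n := le_of_lt (mul_pos hδ h2n)
  have hsum : η₁ * ((univ.filter fun u : Fin n → Bool => ¬ ct (φ u) ≤ T).card : ℝ) +
      ((univ.filter fun u : Fin n → Bool => ringWinU c y u = true ∧ ¬ ct (φ u) ≤ T).card : ℝ) ≤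
      ((univ.filter fun u : Fin n → Bool => ¬ ct (φ u) ≤ T).card : ℝ) +
        (2 : ℝ) ^ K * (η₁ * (1 - θS) / (2 * 2 ^ K) * (2 : ℝ) ^ n) := by
    rw [hBsum, hYsum, Finset.mul_sum, ← Finset.sum_add_distrib]
    refine le_trans (Finset.sum_le_sum hcell) ?_
    rw [Finset.sum_add_distrib, Finset.sum_const, nsmul_eq_mul]
    have hDVcard : (DV.card : ℝ) ≤ (2 : ℝ) ^ K := by
      have : DV.card ≤ Fintype.card (Fin K → Bool) := Finset.card_le_univ _
      rw [Fintype.card_fun, Fintype.card_bool, Fintype.card_fin] at this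
      exact_mod_cast this
    nlinarith [mul_le_mul_of_nonneg_right hDVcard hE0]
  -- (7) arithmetic
  have hW : ((univ.filter fun u : Fin n → Bool => ringWinU c y u = true).card : ℝ) =
      ((univ.filter fun u : Fin n → Bool => ringWinU c y u = true ∧ ct (φ u) ≤ T).card : ℝ) +
      ((univ.filter fun u : Fin n → Bool => ringWinU c y u = true ∧ ¬ ct (φ u) ≤ T).card : ℝ) := by
    exact_mod_cast hWsplit.symm
  have hAB : ((univ.filter fun u : Fin n → Bool => ct (φ u) ≤ T).card : ℝ) +
      ((univ.filter fun u : Fin n → Bool => ¬ ct (φ u) ≤ T).card : ℝ) = (2 : ℝ) ^ n := by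
    exact_mod_cast hABsplit
  have hX2r : ((univ.filter fun u : Fin n → Bool => ringWinU c y u = true ∧ ct (φ u) ≤ T).card : ℝ) ≤
      ((univ.filter fun u : Fin n → Bool => ct (φ u) ≤ T).card : ℝ) := by exact_mod_cast hX2
  have hE : (2 : ℝ) ^ K * (η₁ * (1 - θS) / (2 * 2 ^ K) * (2 : ℝ) ^ n) = η₁ * (1 - θS) / 2 * (2 : ℝ) ^ n := by
    have h2K : (2 : ℝ) ^ K ≠ 0 := by positivity
    field_simp
  rw [hE] at hsum
  have p1 := mul_le_mul_of_nonneg_left hX2r (show (0 : ℝ) ≤ 1 - η₁ by linarith)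
  have p2 := mul_le_mul_of_nonneg_left hX1 hη₁.le
  have p3 : η₁ * ((univ.filter fun u : Fin n → Bool => ct (φ u) ≤ T).card : ℝ) +
      η₁ * ((univ.filter fun u : Fin n → Bool => ¬ ct (φ u) ≤ T).card : ℝ) = η₁ * (2 : ℝ) ^ n := by
    rw [← mul_add, hAB]
  rw [hW]
  linarith

end Rel


end Summit.QuantumAdvantage.QuantumAdvantage.Theorems.PairFreezing
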